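import Literature.MathematicalPhysics.QuantumFieldTheory.Balaban1983to89.B13ConditioningDecoration

/-!
# `Balaban1983to89.B13JointWalkExpansionSymmetrize` — T. Bałaban, *Renormalization group approach to lattice gauge field
theories. II. Cluster expansions*, Commun. Math. Phys. **116** (1988) 1–22 [Balaban1988RG2Cluster], p. 3 (after (1.7)),
(1.11) p. 5, p. 13, p. 15 *"For the pair (U′,0) the operators are symmetric"*, with [13] = [Balaban1985BackgroundPropagators]
Thm 3.10 (3.107)–(3.108) p. 416: THE WALK REVERSAL COMES FOR FREE — the SYMMETRIZED joint walk expansion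
`½·T_ω ⊕ ½·T_ωᵀ` (terms on `W ⊕ W`, the second copy with the walk distance read backwards) of any square kernel family
`K(σ,u)` is a joint walk expansion of `½(K + Kᵀ)` with the SAME letters `(R, ε, κ, K̄)` and carries the reversal
`Sum.swap` (`T′(swap ω) = (T′ ω)ᵀ`) by construction; for a symmetric family (`Kᵀ = K`) it is an expansion of `K` itself.
Composed with `B13ConditioningDecoration` (print's s-decoration + the C-sandwich) this removes the binder «a walk reversal
compatible with the cube sets» from the σ-free input of the N10 junction: a σ-FREE joint walk expansion of the fluctuation
operator through `X` with walk distances dominating `d₁` — nothing else — yields the structured datum `hKexp` for the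
print-defined conditioned operator `Cᵀ·Δ(s,·)·C`, where `Δ(s,·)` decorates the SYMMETRIZED σ-free expansion

statement-level bookkeeping over published theorems with citation tags; kernel-checked compositions of tree theorems;
nothing here is a claim about the Yang–Mills mass gap.

WHY (cell `pub-ymgap`, D-0062 Track A, node N10 = [B13]; seat `pub-ymgap-dag-n10-c` g4, module 25; census
`N10-RESIDUAL-CENSUS-v3.md` class A2′).  After modules 17–24 the NODE-A input of the N10 record junction
(`Summit…N10AtRecord11B13WalksBlockMonomialHolo`, binder `hKexp`) reads, per (2.14)-term: ONE σ-free joint walk expansion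
of `Δ₀(u)` through `X` + a WALK REVERSAL `rev : W ≃ W` with `T₀ (rev ω) = (T₀ ω)ᵀ`, `J (rev ω) = J ω` + (1.11)'s decoration
geometry + `C`'s letters.  [13]'s expansion (3.107) `G = Σ_ω R₀(X₀)R_{α₁}(X₁)⋯R_{αₙ}(Xₙ)` of a symmetric operator is NOT
termwise reversal-invariant (the reversed product is not a term of the same sum), so a supplier would have had to
symmetrize anyway; only the quadratic form of `Δ_k(σ)` enters (2.5)–(2.9), i.e. only its symmetric part, and print p. 15
uses symmetry at `(U′, 0)`.  This file does the symmetrization ONCE at the level of the shape: the reversal binder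
disappears from the census, replaced by nothing.

WHAT THIS FILE PROVES (all `theorem`s; no `def`, no instance, no notation).
§1 `jointWalkExpansion_congr_on` — the kernel family enters the shape only through `hasSum`: transport along an equality
   of kernels on polydisc × ball (used for `½(K + Kᵀ) = K` when `K` is symmetric).
§2 ★ `jointWalkExpansion_symmetrize` — `h : JointWalkExpansion c loc loc K X R ε κ K̄ T SX A D ρ` (square) ⟹ the
   family `ω ↦ ½·T_ω` on the left copy, `ω ↦ ½·T_ωᵀ` on the right copy of `W ⊕ W` (σ-carrying sub-family, amplitudes
   `½A_ω`, distances `D_ω` resp. `D_ω` read backwards) is a joint walk expansion of `½K + ½Kᵀ` with the same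
   `(R, ε, κ, K̄)`; `symmetrize_reversal` — `T′ (Sum.swap ω) σ u i j = T′ ω σ u j i`; `domBy_symmetrize`;
   `jointWalkExpansion_symmetrize_of_symm` — for `Kᵀ = K` on polydisc × ball, an expansion of `K` with a reversal.
§3 ★ `structuredExpansion_sandwich_sDecorate_symm` — module 24's composite `structuredExpansion_sandwich_sDecorate`
   with the three reversal binders `rev hrevT hrevJ` REMOVED: a σ-free expansion of `Δ₀` through `X` (distances
   dominating `d₁`) + a decoration `J` under print's (P1)∕(P2) at rate `η` + the through-clause + a real constant local
   `C` + fibre bound + junction rate ⟹ the structured datum (`∃ W T SX A D ρ′ J′ T0 rev′`, joint walk expansion ∧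
   s-monomial terms ∧ reversal) for `K = Cᵀ·(sDecorate J′ T₀′)·C`, `J′ = J ∘ Sum.elim id id`, `T₀′` the symmetrized
   σ-free family — literally the `hKexp` binder of the N10 junction for that operator; `sDecorate_symmetrize_symm` — the
   decorated symmetrized kernel is complex-symmetric for every `(s,u)` (termwise, no summability needed).
HONEST FRAMING: kernel-level bookkeeping (finite matrices, absolutely convergent series) over the tree's hypothesis
SHAPE; NOTHING of Bałaban's `Δ_k(𝐔,𝐉)` is constructed — whether HIS fluctuation operator admits a σ-free joint walk
expansion k-uniformly at complex backgrounds ([13] Thm 3.10 for the operators determining `Δ_k`; in-edge N06 ∕ the (D4)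
programme) stays the INPUT; count-neutral; NOT a discharge of N10; no `sorry`, no new named fact; standard axioms;
nothing continuum ∕ ℝ⁴ ∕ OS ∕ mass gap ∕ Clay.
-/

noncomputable section

namespace Literature.MathematicalPhysics.QuantumFieldTheory.Balaban1983to89.B13JointWalkExpansionSymmetrize

open Metric Set Finset
open scoped Matrix
open Literature.MathematicalPhysics.QuantumFieldTheory.Balaban1983to89
open Literature.MathematicalPhysics.QuantumFieldTheory.Balaban1983to89.B9SectDWalk (DomBy Through MajSumLe)
open Literature.MathematicalPhysics.QuantumFieldTheory.Balaban1983to89.B9Thm34Ext (toB6)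
open Literature.MathematicalPhysics.QuantumFieldTheory.Balaban1983to89.B9Thm37GlueTorus (torusGeom tdist1 tdist1_comm)
open Literature.MathematicalPhysics.QuantumFieldTheory.Balaban1983to89.TreeLengthTorus (TPt)
open Literature.MathematicalPhysics.QuantumFieldTheory.Balaban1983to89.B5TorusCover (UT)
open Literature.MathematicalPhysics.QuantumFieldTheory.Balaban1983to89.B13JointWalkExpansion (JointWalkExpansion)
open Literature.MathematicalPhysics.QuantumFieldTheory.Balaban1983to89.B13JointWalkExpansionAlgebra
  (jointWalkExpansion_transpose jointWalkExpansion_smul jointWalkExpansion_add_same)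
open Literature.MathematicalPhysics.QuantumFieldTheory.Balaban1983to89.B13Eq111SDecoupling (sTerm sDecorate sTerm_apply
  sDecorate_apply)
open Literature.MathematicalPhysics.QuantumFieldTheory.Balaban1983to89.B13ConditioningDecoration
  (structuredExpansion_sandwich_sDecorate)

variable {ν : ℕ} {Nf : Fin ν → ℕ} [∀ i, NeZero (Nf i)]
variable {d N' : ℕ} {p n : Type}
variable {E : Type*} [NormedAddCommGroup E] [NormedSpace ℂ E]

/-! ## §1. Transport along an equality of kernel families -/

section Congr

variable {c : B13.Consts} {locp : p → UT Nf} {locn : n → UT Nf} {K K' : (TPt d N' → ℂ) → E → Matrix p n ℂ}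
variable {X : Finset (UT Nf)} {R ε kap Kbar : ℝ}
variable {W : Type} {T : W → (TPt d N' → ℂ) → E → Matrix p n ℂ} {SX : Set W} {A : W → ℝ}
variable {D : W → UT Nf → UT Nf → ℝ} {ρ : ℝ}

/-- **TRANSPORT**: the kernel family enters `JointWalkExpansion` only through the `hasSum` field, so two families that
agree ON POLYDISC × BALL have the same joint walk expansions (same terms, same letters) — the Literature home, in the
sharper «on the domain only» form, of the Summit-side `Gaps.D4WalkModelFull.jointWalkExpansion_congr` (equality
everywhere). [cite: Balaban1985BackgroundPropagators, (3.107) p.416] -/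
theorem jointWalkExpansion_congr_on (h : JointWalkExpansion c locp locn K X R ε kap Kbar T SX A D ρ)
    (hKK' : ∀ σ : TPt d N' → ℂ, (∀ j, ‖σ j‖ ≤ Real.exp c.κ₁) → ∀ u ∈ ball (0 : E) R, K σ u = K' σ u) :
    JointWalkExpansion c locp locn K' X R ε kap Kbar T SX A D ρ where
  hasSum σ hσ u hu i j := by rw [← hKK' σ hσ u hu]; exact h.hasSum σ hσ u hu i j
  termAnalytic := h.termAnalytic
  maj := h.maj
  majSum := h.majSum
  indep := h.indep
  through := h.through
  A_nonneg := h.A_nonneg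
  D_nonneg := h.D_nonneg

end Congr

/-! ## §2. The symmetrized expansion carries the reversal `Sum.swap` -/

section Symmetrize

variable {c : B13.Consts} {loc : p → UT Nf} {K : (TPt d N' → ℂ) → E → Matrix p p ℂ}
variable {X : Finset (UT Nf)} {R ε kap Kbar : ℝ}
variable {W : Type} {T : W → (TPt d N' → ℂ) → E → Matrix p p ℂ} {SX : Set W} {A : W → ℝ}
variable {D : W → UT Nf → UT Nf → ℝ} {ρ : ℝ}

omit [∀ i, NeZero (Nf i)] in
/-- The norm of the complex number `½` is `½`. [folklore] -/
private theorem norm_half : ‖(1 / 2 : ℂ)‖ = 1 / 2 := by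
  rw [norm_div, norm_one, Complex.norm_ofNat]

/-- **THE SYMMETRIZED EXPANSION** ([13] (3.107) read together with its transpose; print p. 15: only the symmetric part
of the quadratic form's operator matters).  From a joint walk expansion of a square family `K` (rows and columns located
by the same `loc`): the family on `W ⊕ W` with terms `½·T_ω` (left copy) and `½·T_ωᵀ` (right copy), σ-carrying
sub-family `SX ⊕ SX`, amplitudes `½A_ω`, walk distances `D_ω` resp. `(a,b) ↦ D_ω(b,a)`, is a joint walk expansion of
`½K + ½Kᵀ` with the SAME ball, drop, torus rate and constant `(R, ε, κ, K̄)` (`jointWalkExpansion_smul` + `_transpose` +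
`_add_same`, constant `½K̄ + ½K̄`). [cite: Balaban1988RG2Cluster, p.15, p.13; Balaban1985BackgroundPropagators, (3.107)–(3.108) p.416] -/
theorem jointWalkExpansion_symmetrize (h : JointWalkExpansion c loc loc K X R ε kap Kbar T SX A D ρ) (hK : 0 ≤ Kbar) :
    JointWalkExpansion c loc loc (fun σ u => (1 / 2 : ℂ) • K σ u + (1 / 2 : ℂ) • (K σ u)ᵀ) X R ε kap Kbar
      (fun (ω : W ⊕ W) σ u => Sum.elim (fun ω => (1 / 2 : ℂ) • T ω σ u) (fun ω => (1 / 2 : ℂ) • (T ω σ u)ᵀ) ω)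
      {ω | Sum.elim (· ∈ SX) (· ∈ SX) ω}
      (fun ω => Sum.elim (fun ω => (1 / 2 : ℝ) * A ω) (fun ω => (1 / 2 : ℝ) * A ω) ω)
      (fun ω => Sum.elim D (fun ω a b => D ω b a) ω) ρ := by
  have h₁ := jointWalkExpansion_smul h (1 / 2 : ℂ)
  have h₂ := jointWalkExpansion_smul (jointWalkExpansion_transpose h) (1 / 2 : ℂ)
  have hs := jointWalkExpansion_add_same h₁ h₂ (by positivity) (by positivity)
  -- the data of `hs` are the displayed lambdas up to `Sum.elim` bookkeeping and `‖½‖ = ½`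
  convert hs using 1
  · rw [norm_half]; ring
  · funext ω σ u; rcases ω with ω | ω <;> rfl
  · funext ω; rcases ω with ω | ω <;> simp

omit [∀ i, NeZero (Nf i)] [NormedAddCommGroup E] [NormedSpace ℂ E] in
/-- **THE REVERSAL**: swapping the two copies transposes the terms — `T′ (Sum.swap ω) σ u i j = T′ ω σ u j i`.
[cite: Balaban1985BackgroundPropagators, (3.107) p.416] -/
theorem symmetrize_reversal (T : W → (TPt d N' → ℂ) → E → Matrix p p ℂ) (ω : W ⊕ W) (σ : TPt d N' → ℂ) (u : E)
    (i j : p) :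
    Sum.elim (fun ω => (1 / 2 : ℂ) • T ω σ u) (fun ω => (1 / 2 : ℂ) • (T ω σ u)ᵀ) ((Equiv.sumComm W W) ω) i j =
      Sum.elim (fun ω => (1 / 2 : ℂ) • T ω σ u) (fun ω => (1 / 2 : ℂ) • (T ω σ u)ᵀ) ω j i := by
  rcases ω with ω | ω <;> simp [Matrix.smul_apply, Matrix.transpose_apply]

omit [∀ i, NeZero (Nf i)] in
/-- **A decoration read on both copies is reversal-compatible**: `J′ (Sum.swap ω) = J′ ω` for `J′ = J ∘ Sum.elim id id`.
[cite: Balaban1988RG2Cluster, (1.11) p.5] -/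
theorem symmetrize_cubes {ι : Type} (J : W → ι) (ω : W ⊕ W) :
    J (Sum.elim id id ((Equiv.sumComm W W) ω)) = J (Sum.elim id id ω) := by
  rcases ω with ω | ω <;> rfl

/-- **Domination survives** (`d₁` is symmetric on the torus). [cite: Balaban1984PropagatorsII, (2.54) p.233] -/
theorem domBy_symmetrize (hdom : ∀ ω, DomBy (toB6 (torusGeom Nf 0 0 0) 0 True) (D ω)) (ω : W ⊕ W) :
    DomBy (toB6 (torusGeom Nf 0 0 0) 0 True) (Sum.elim D (fun ω a b => D ω b a) ω) := by
  rcases ω with ω | ω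
  · exact hdom ω
  · intro y y'
    have e1 : (toB6 (torusGeom Nf 0 0 0) 0 True).dist y y' = tdist1 Nf y y' := rfl
    have e2 : (toB6 (torusGeom Nf 0 0 0) 0 True).dist y' y = tdist1 Nf y' y := rfl
    have h := hdom ω y' y
    rw [e2] at h
    rw [Sum.elim_inr, e1, tdist1_comm y y']
    exact h

/-- **A through-clause survives** on the backwards copy (symmetry of `d₁`). [cite: Balaban1985BackgroundPropagators, (3.93) p.410] -/
theorem through_symmetrize {Y : Set (UT Nf)} {ω : W} (h : Through (toB6 (torusGeom Nf 0 0 0) 0 True) (D ω) Y) :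
    Through (toB6 (torusGeom Nf 0 0 0) 0 True) (fun a b => D ω b a) Y := by
  intro y y'
  obtain ⟨z, hz, hle⟩ := h y' y
  refine ⟨z, hz, ?_⟩
  have e1 : (toB6 (torusGeom Nf 0 0 0) 0 True).dist y z = tdist1 Nf y z := rfl
  have e2 : (toB6 (torusGeom Nf 0 0 0) 0 True).dist z y' = tdist1 Nf z y' := rfl
  have e3 : (toB6 (torusGeom Nf 0 0 0) 0 True).dist y' z = tdist1 Nf y' z := rfl
  have e4 : (toB6 (torusGeom Nf 0 0 0) 0 True).dist z y = tdist1 Nf z y := rfl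
  rw [e1, e2]; rw [e3, e4] at hle
  rw [tdist1_comm y z, tdist1_comm z y']
  linarith

/-- **FOR A SYMMETRIC FAMILY THE SYMMETRIZED EXPANSION IS AN EXPANSION OF `K` ITSELF, WITH A REVERSAL** (print p. 15:
*"For the pair (U′,0) the operators are symmetric"*; at complex backgrounds the fluctuation operator is complex-symmetric
as the analytic continuation of a symmetric one). [cite: Balaban1988RG2Cluster, p.15; Balaban1985BackgroundPropagators, (3.107)–(3.108) p.416] -/
theorem jointWalkExpansion_symmetrize_of_symm (h : JointWalkExpansion c loc loc K X R ε kap Kbar T SX A D ρ)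
    (hK : 0 ≤ Kbar) (hsymm : ∀ σ : TPt d N' → ℂ, (∀ j, ‖σ j‖ ≤ Real.exp c.κ₁) → ∀ u ∈ ball (0 : E) R, (K σ u)ᵀ = K σ u) :
    JointWalkExpansion c loc loc K X R ε kap Kbar
      (fun (ω : W ⊕ W) σ u => Sum.elim (fun ω => (1 / 2 : ℂ) • T ω σ u) (fun ω => (1 / 2 : ℂ) • (T ω σ u)ᵀ) ω)
      {ω | Sum.elim (· ∈ SX) (· ∈ SX) ω}
      (fun ω => Sum.elim (fun ω => (1 / 2 : ℝ) * A ω) (fun ω => (1 / 2 : ℝ) * A ω) ω)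
      (fun ω => Sum.elim D (fun ω a b => D ω b a) ω) ρ :=
  jointWalkExpansion_congr_on (jointWalkExpansion_symmetrize h hK) fun σ hσ u hu => by
    rw [hsymm σ hσ u hu, ← add_smul]; norm_num

end Symmetrize

/-! ## §3. The N10 junction's structured datum from a σ-free expansion WITHOUT a reversal -/

section Composite

variable [Fintype p]
variable {c : B13.Consts} {locF : p → UT Nf} {locN : n → UT Nf} {Δ₀ : E → Matrix p p ℂ} {X : Finset (UT Nf)}
variable {R ε kap Kbar ρ : ℝ} {W : Type} {T₀ : W → E → Matrix p p ℂ} {SX₀ : Set W} {A : W → ℝ}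
variable {D : W → UT Nf → UT Nf → ℝ}

omit [∀ i, NeZero (Nf i)] [Fintype p] [NormedAddCommGroup E] [NormedSpace ℂ E] in
/-- **THE DECORATED SYMMETRIZED KERNEL IS COMPLEX-SYMMETRIC** for every `(s,u)` — termwise: the swap of the two copies is
a bijection of the term family exchanging each decorated term with its transpose (no summability needed: a non-summable
entry series and its reindexing both have `tsum = 0`). [cite: Balaban1988RG2Cluster, p.3 (after (1.7)), (1.11) p.5, p.15] -/
theorem sDecorate_symmetrize_symm (J : W → Finset (TPt d N')) (T₀ : W → E → Matrix p p ℂ) (σ : TPt d N' → ℂ) (u : E) :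
    (sDecorate (fun ω : W ⊕ W => J (Sum.elim id id ω))
        (fun ω u => Sum.elim (fun ω => (1 / 2 : ℂ) • T₀ ω u) (fun ω => (1 / 2 : ℂ) • (T₀ ω u)ᵀ) ω) σ u)ᵀ =
      sDecorate (fun ω : W ⊕ W => J (Sum.elim id id ω))
        (fun ω u => Sum.elim (fun ω => (1 / 2 : ℂ) • T₀ ω u) (fun ω => (1 / 2 : ℂ) • (T₀ ω u)ᵀ) ω) σ u := by
  ext i j
  rw [Matrix.transpose_apply, sDecorate_apply, sDecorate_apply]
  rw [← (Equiv.sumComm W W).tsum_eq]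
  refine tsum_congr fun ω => ?_
  rw [sTerm_apply, sTerm_apply]
  rcases ω with ω | ω <;> simp [Matrix.smul_apply, Matrix.transpose_apply]

/-- **THE STRUCTURED DATUM OF THE N10 JUNCTION FROM [13]'s σ-FREE EXPANSION — NO REVERSAL ASKED.**  Module 24's
`structuredExpansion_sandwich_sDecorate` with its binders `rev`, `hrevT`, `hrevJ` discharged by §2: DATA a σ-free joint
walk expansion `h₀` of `Δ₀(u)` through `X` at `(R, ε, κ, K̄)`, rate `ρ`, walk distances dominating `d₁`; a decoration `J`
(the σ₀-cubes met) under print's dichotomy (P1) `|J ω| ≤ m₀ ∨ δ₁M·|J ω| ≤ ρ·D_ω` and restriction (P2) `κ₁ρ ≤ η·δ₁M`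
(`0 ≤ η ≤ ε`) with the through-clause; a real constant local `C` (`|C k i| ≤ 1`, range `r_C`), a fibre bound `m_F`, a
junction rate `μ > 0` with `2μ ≤ ε − η`, `2μ ≤ κ`, `κ ≤ (ρ − η) − (ε − η)`.  CONCLUSION: `∃ W′ T′ SX′ A′ D′ ρ′ J′ T0′ rev′`,
ONE joint walk expansion of `(s,u) ↦ Cᵀ·(sDecorate J′ T₀′ s u)·C` through `X` at `(R, ε − η − 2μ, κ − 2μ, K̄_S)` with
s-MONOMIAL terms and a WALK REVERSAL, where `J′ = J ∘ Sum.elim id id` and `T₀′` is the symmetrized σ-free family on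
`W ⊕ W` — the binder `hKexp` of `Summit…N10AtRecord11B13WalksBlockMonomialHolo` for the print-defined conditioned
operator built on the SYMMETRIZED expansion (complex-symmetric for all `(s,u)`, `sDecorate_symmetrize_symm`; its σ-free
sum is `½(Δ₀ + Δ₀ᵀ) = Δ₀` for symmetric `Δ₀`).  `K̄_S` is module 24's explicit constant verbatim.
[cite: Balaban1988RG2Cluster, p.3, (1.11) p.5, (2.5) p.12, p.13, p.15; Balaban1985BackgroundPropagators, (3.93) p.410, (3.107)–(3.108) p.416, p.422, Thm 3.12 p.423; Balaban1984PropagatorsII, (2.54) p.233, Lemma 2.1 (2.61) p.234] -/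
theorem structuredExpansion_sandwich_sDecorate_symm (hκ₁ : 0 ≤ c.κ₁)
    (h₀ : JointWalkExpansion c locF locF (fun (_ : TPt d N' → ℂ) => Δ₀) X R ε kap Kbar
      (fun ω (_ : TPt d N' → ℂ) => T₀ ω) SX₀ A D ρ)
    (hdom : ∀ ω, DomBy (toB6 (torusGeom Nf 0 0 0) 0 True) (D ω))
    (J : W → Finset (TPt d N'))
    {m₀ : ℕ} {dM η : ℝ} (hdM : 0 < dM) (hη : 0 ≤ η) (hηε : η ≤ ε)
    (hdich : ∀ ω, (J ω).card ≤ m₀ ∨ ∀ a b, dM * (J ω).card ≤ ρ * D ω a b) (hR1 : c.κ₁ * ρ ≤ η * dM)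
    (hX : ∀ ω, (J ω).Nonempty → Through (toB6 (torusGeom Nf 0 0 0) 0 True) (D ω) (↑X : Set (UT Nf)))
    (C : Matrix p n ℝ) {rC : ℝ} (hCle : ∀ k i, |C k i| ≤ 1)
    (hCsupp : ∀ k i, C k i ≠ 0 → tdist1 Nf (locF k) (locN i) ≤ rC)
    {mF : ℕ} (hfibF : ∀ y : UT Nf, (Finset.univ.filter fun k => locF k = y).card ≤ mF)
    {μ : ℝ} (hμ : 0 < μ) (hμε : 2 * μ ≤ ε - η) (hμκ : 2 * μ ≤ kap) (hκε : kap ≤ (ρ - η) - (ε - η)) (hKbar : 0 ≤ Kbar) :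
    ∃ (W' : Type) (T' : W' → (TPt d N' → ℂ) → E → Matrix n n ℂ) (SX' : Set W') (A' : W' → ℝ)
      (D' : W' → UT Nf → UT Nf → ℝ) (ρ' : ℝ) (J' : W' → Finset (TPt d N')) (T0' : W' → E → Matrix n n ℂ) (rev' : W' ≃ W'),
      JointWalkExpansion c locN locN
          (fun σ u => (C.map (algebraMap ℝ ℂ))ᵀ *
            sDecorate (fun ω : W ⊕ W => J (Sum.elim id id ω))
              (fun ω u => Sum.elim (fun ω => (1 / 2 : ℂ) • T₀ ω u) (fun ω => (1 / 2 : ℂ) • (T₀ ω u)ᵀ) ω) σ u *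
            C.map (algebraMap ℝ ℂ)) X R
          (ε - η - μ - μ) (kap - μ - μ)
          ((mF * B6.c0 1 μ ^ ν) * ((mF * B6.c0 1 μ ^ ν) * Real.exp ((ρ - η) * rC) * (Real.exp (c.κ₁ * m₀) * Kbar)
            * B6.c0 1 μ ^ ν) * Real.exp ((ρ - η - μ) * rC) * B6.c0 1 μ ^ ν) T' SX' A' D' ρ' ∧
        (∀ ω σ u, T' ω σ u = (∏ j ∈ J' ω, σ j) • T0' ω u) ∧ (∀ ω σ u i j, T' (rev' ω) σ u i j = T' ω σ u j i) := by
  -- the symmetrized σ-free expansion (σ-constant terms: the σ-slot is ignored on both copies)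
  have hs := jointWalkExpansion_symmetrize h₀ hKbar
  have hs' : JointWalkExpansion c locF locF
      (fun (_ : TPt d N' → ℂ) u => (1 / 2 : ℂ) • Δ₀ u + (1 / 2 : ℂ) • (Δ₀ u)ᵀ) X R ε kap Kbar
      (fun (ω : W ⊕ W) (_ : TPt d N' → ℂ) u =>
        Sum.elim (fun ω => (1 / 2 : ℂ) • T₀ ω u) (fun ω => (1 / 2 : ℂ) • (T₀ ω u)ᵀ) ω)
      {ω | Sum.elim (· ∈ SX₀) (· ∈ SX₀) ω}
      (fun ω => Sum.elim (fun ω => (1 / 2 : ℝ) * A ω) (fun ω => (1 / 2 : ℝ) * A ω) ω)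
      (fun ω => Sum.elim D (fun ω a b => D ω b a) ω) ρ := by
    convert hs using 2
  refine structuredExpansion_sandwich_sDecorate hκ₁ hs' (domBy_symmetrize hdom) (Equiv.sumComm W W)
    (fun ω u i j => ?_) (fun ω => J (Sum.elim id id ω)) (symmetrize_cubes J) hdM hη hηε (fun ω => ?_) hR1
    (fun ω hω => ?_) C hCle hCsupp hfibF hμ hμε hμκ hκε hKbar
  · rcases ω with ω | ω <;> simp [Matrix.smul_apply, Matrix.transpose_apply]
  · rcases ω with ω | ω
    · exact hdich ω
    · rcases hdich ω with h | h
      · exact Or.inl h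
      · exact Or.inr fun a b => h b a
  · rcases ω with ω | ω
    · exact hX ω hω
    · exact through_symmetrize (hX ω hω)

end Composite

end Literature.MathematicalPhysics.QuantumFieldTheory.Balaban1983to89.B13JointWalkExpansionSymmetrize

end
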